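import Literature.Analysis.UnboundedOperators.LumerPhillipsRangeCondition
import Literature.Analysis.UnboundedOperators.ClosedFormOperator
import HarnessLib

/-!
# The semigroup `e^{−tT}` of the operator of a closed symmetric form bounded below (Kato VI Thm. 2.6 +
  Lumer–Phillips / Engel–Nagel II Thm. 3.15): `‖e^{−tT}‖ ≤ e^{−γt}` when `𝔥 ≥ γ`

Analysis/UnboundedOperators proofs-layer file (theorems only, no definitions, no named facts). The tree's
`formOperator J : H →ₗ.[ℂ] H` (`ClosedFormOperator.lean`) is Kato's self-adjoint operator `T = T_𝔥` of the
densely defined closed symmetric form `𝔥[x, y] = ⟪x, y⟫_Q − ⟪Jx, Jy⟫_H` recorded in the `(Q, J)` format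
(`J : Q →L[ℂ] H` injective with dense range). If `𝔥 ≥ γ` (`γ‖Jx‖² ≤ 𝔥[x]`), then `−T` is densely defined
with `Re⟪−Tu, u⟫ ≤ −γ‖u‖²` (`formOperator_lowerBound`) and `T + 1` is onto (`range_formOperator_add_one`) —
the range condition at the single point `λ₀ = 1 > −γ` — so by `LumerPhillipsRangeCondition` /
`LumerPhillipsQuasi` the operator `−T` generates a C₀-semigroup `S` with `‖S(t)‖ ≤ e^{−γt}` (the «heat
semigroup» `e^{−tT}` of the form; e.g. Schrödinger/Dirichlet forms):

* `re_inner_neg_formOperator_le`, `surj_one_add_formOperator`,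
  `isQuasiDissipativeData_neg_formOperator`;
* **`exists_c0Semigroup_neg_formOperator`** — `∃ S`, `‖S(t)‖ ≤ e^{−γt}`, `S.generator = −formOperator J`
  (for `γ > −1`; every such form admits some `γ > −1`, e.g. `γ = ‖J‖⁻² − 1`), unique by
  `C0Semigroup.eq_of_generator_eq`.

## References

* T. Kato, *Perturbation Theory for Linear Operators* (1966), VI §2.1 Thm. 2.1, Thm. 2.6; IX §1. [Kato1966]
* K.-J. Engel, R. Nagel, *One-Parameter Semigroups for Linear Evolution Equations* (2000), Ch. II
  Prop. 3.14, Thm. 3.15. [EngelNagel2000]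
-/

noncomputable section

open scoped NNReal InnerProductSpace

namespace Literature.Analysis.UnboundedOperators

variable {Q : Type*} [NormedAddCommGroup Q] [InnerProductSpace ℂ Q] [CompleteSpace Q]
variable {H : Type*} [NormedAddCommGroup H] [InnerProductSpace ℂ H] [CompleteSpace H]
variable {J : Q →L[ℂ] H}

/-- **Numerical range of `−T_𝔥`**: `𝔥 ≥ γ` ⇒ `Re⟪(−T)u, u⟫ ≤ −γ‖u‖²` on `D(T)`. [cite: Kato1966, VI §2.1 Thm 2.6] -/
theorem re_inner_neg_formOperator_le (hJi : Function.Injective J) (hJd : DenseRange J) {γ : ℝ}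
    (hγ : ∀ x : Q, γ * ‖J x‖ ^ 2 ≤ ‖x‖ ^ 2 - ‖J x‖ ^ 2) (u : (-formOperator J).domain) :
    (⟪((-formOperator J) u : H), (u : H)⟫_ℂ).re ≤ -γ * ‖(u : H)‖ ^ 2 := by
  have h := formOperator_lowerBound hJi hJd hγ u
  rw [RCLike.re_to_complex] at h
  rw [LinearPMap.neg_apply, inner_neg_left, Complex.neg_re]
  linarith

/-- **The range condition at `λ₀ = 1`**: `T + 1` is onto, i.e. `1·x − (−T)x = y` is solvable. [cite: Kato1966, VI §2.2] -/
theorem surj_one_add_formOperator (hJi : Function.Injective J) (hJd : DenseRange J) (y : H) :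
    ∃ x : (-formOperator J).domain, ((1 : ℝ) : ℂ) • (x : H) - (-formOperator J) x = y := by
  obtain ⟨x, hx⟩ := LinearMap.range_eq_top.1 (range_formOperator_add_one hJi hJd) y
  refine ⟨x, ?_⟩
  rw [subSMul_apply] at hx
  rw [LinearPMap.neg_apply, Complex.ofReal_one, one_smul, sub_neg_eq_add, ← hx, neg_smul, one_smul, sub_neg_eq_add, add_comm]

/-- **`−T_𝔥` is `(−γ)`-quasi-dissipative with the range condition** (`γ > −1`). [cite: EngelNagel2000, Ch. II Prop. 3.14] -/
theorem isQuasiDissipativeData_neg_formOperator (hJi : Function.Injective J) (hJd : DenseRange J) {γ : ℝ}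
    (hγ : ∀ x : Q, γ * ‖J x‖ ^ 2 ≤ ‖x‖ ^ 2 - ‖J x‖ ^ 2) (hγ1 : -1 < γ) :
    HilleYosida.IsQuasiDissipativeData (-formOperator J) (-γ) :=
  HilleYosida.IsQuasiDissipativeData.of_re_inner_le_of_surj_at (l₀ := 1) (dense_formOperator_domain hJi hJd)
    (re_inner_neg_formOperator_le hJi hJd hγ) (by linarith) (surj_one_add_formOperator hJi hJd)

/-- **THE SEMIGROUP OF A CLOSED SYMMETRIC FORM BOUNDED BELOW (Kato VI Thm. 2.6 + Lumer–Phillips).** If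
`𝔥 ≥ γ > −1` then `−T_𝔥` generates a C₀-semigroup `S = e^{−tT}` with `‖S(t)‖ ≤ e^{−γt}` (a contraction
semigroup when `𝔥 ≥ 0`); `S` is unique (`C0Semigroup.eq_of_generator_eq`). [cite: EngelNagel2000, Ch. II Thm. 3.15] -/
theorem exists_c0Semigroup_neg_formOperator (hJi : Function.Injective J) (hJd : DenseRange J) {γ : ℝ}
    (hγ : ∀ x : Q, γ * ‖J x‖ ^ 2 ≤ ‖x‖ ^ 2 - ‖J x‖ ^ 2) (hγ1 : -1 < γ) :
    ∃ S : C0Semigroup ℂ H, (∀ t : ℝ≥0, ‖S.app t‖ ≤ Real.exp (-γ * t)) ∧ S.generator = -formOperator J := by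
  obtain ⟨S, hS, -, hgen⟩ := (isQuasiDissipativeData_neg_formOperator hJi hJd hγ hγ1).exists_c0Semigroup
  exact ⟨S, hS, hgen⟩

/-- The nonnegative case `𝔥 ≥ 0`: `−T_𝔥` generates a CONTRACTION semigroup. [cite: EngelNagel2000, Ch. II Thm. 3.15] -/
theorem exists_c0Semigroup_neg_formOperator_of_nonneg (hJi : Function.Injective J) (hJd : DenseRange J)
    (h0 : ∀ x : Q, ‖J x‖ ^ 2 ≤ ‖x‖ ^ 2) :
    ∃ S : C0Semigroup ℂ H, S.IsContraction ∧ S.generator = -formOperator J := by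
  have hγ : ∀ x : Q, (0 : ℝ) * ‖J x‖ ^ 2 ≤ ‖x‖ ^ 2 - ‖J x‖ ^ 2 := fun x => by rw [zero_mul]; linarith [h0 x]
  obtain ⟨S, hS, hgen⟩ := exists_c0Semigroup_neg_formOperator hJi hJd hγ (by norm_num)
  exact ⟨S, fun t => by simpa using hS t, hgen⟩

end Literature.Analysis.UnboundedOperators
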